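import Summits.KontsevichZagierPeriods.Zeta5Search.LaiSweepShard

/-!
# `κ₃` sweep certificate — shard file 118 of 127 (shards 826–832 of 889)

HONEST FRAMING. Systematic search; no irrationality claim unless certified. This file only checks,
by `decide +kernel`, shards 826–832 of the order-cell sweep of the `κ₃` point `(74, 2180, 444; δ74)`
(engine `LaiSweepEngine`, soundness `LaiSweepJump/Free/Eval/Shard/Kappa3`; a shard is `⟨regime, n,
p, q, p', q', Lo, Up⟩`: `n` cells from `p/q` to `p'/q'` with integer rate sums in `[Lo, Up]`, `K =
128`, `D = 2^40`). It draws NO conclusion: only the capstone `LaiKappa3SweepCert`, which needs all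
127 shard files, does. Kernel cost of this file ≈ 560 cells × 0.3 s.
-/

namespace Summit.KontsevichZagierPeriods.Zeta5Search.Sweep

set_option maxHeartbeats 100000000 in
/-- Shard 826: 80 cells of regime B from `199/216` to `381/413`.
[cite: Lai2024BallRivoal, §4 Lemma 4.3] -/
theorem shard826 :
    Shard.check 128 (2^40)
      ⟨true, 80, 199, 216, 381, 413, 10047109009078, 17281008316687⟩ = true := by
  decide +kernel

set_option maxHeartbeats 100000000 in
/-- Shard 827: 80 cells of regime B from `381/413` to `376/407`.
[cite: Lai2024BallRivoal, §4 Lemma 4.3] -/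
theorem shard827 :
    Shard.check 128 (2^40)
      ⟨true, 80, 381, 413, 376, 407, 10802033484124, 18598911005628⟩ = true := by
  decide +kernel

set_option maxHeartbeats 100000000 in
/-- Shard 828: 80 cells of regime B from `376/407` to `284/307`.
[cite: Lai2024BallRivoal, §4 Lemma 4.3] -/
theorem shard828 :
    Shard.check 128 (2^40)
      ⟨true, 80, 376, 407, 284, 307, 10249966411625, 17666820434882⟩ = true := by
  decide +kernel

set_option maxHeartbeats 100000000 in
/-- Shard 829: 80 cells of regime B from `284/307` to `88/95`.
[cite: Lai2024BallRivoal, §4 Lemma 4.3] -/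
theorem shard829 :
    Shard.check 128 (2^40)
      ⟨true, 80, 284, 307, 88, 95, 10127419520575, 17473362169225⟩ = true := by
  decide +kernel

set_option maxHeartbeats 100000000 in
/-- Shard 830: 80 cells of regime B from `88/95` to `1114/1201`.
[cite: Lai2024BallRivoal, §4 Lemma 4.3] -/
theorem shard830 :
    Shard.check 128 (2^40)
      ⟨true, 80, 88, 95, 1114, 1201, 10200826074168, 17617878186300⟩ = true := by
  decide +kernel

set_option maxHeartbeats 100000000 in
/-- Shard 831: 80 cells of regime B from `1114/1201` to `248/267`.
[cite: Lai2024BallRivoal, §4 Lemma 4.3] -/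
theorem shard831 :
    Shard.check 128 (2^40)
      ⟨true, 80, 1114, 1201, 248, 267, 10476213958817, 18112369538854⟩ = true := by
  decide +kernel

set_option maxHeartbeats 100000000 in
/-- Shard 832: 80 cells of regime B from `248/267` to `1117/1201`.
[cite: Lai2024BallRivoal, §4 Lemma 4.3] -/
theorem shard832 :
    Shard.check 128 (2^40)
      ⟨true, 80, 248, 267, 1117, 1201, 9980469194517, 17272725953938⟩ = true := by
  decide +kernel

/-- The checked shards of this file, in order. [folklore] -/
def shards118 : List (CheckedShard 128 (2^40)) :=
  [⟨_, shard826⟩, ⟨_, shard827⟩, ⟨_, shard828⟩, ⟨_, shard829⟩, ⟨_, shard830⟩,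
    ⟨_, shard831⟩, ⟨_, shard832⟩]

end Summit.KontsevichZagierPeriods.Zeta5Search.Sweep
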